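import Literature.AnabelianGeometry.AbsoluteAnabelian.DiagramMorphisms
import Mathlib.CategoryTheory.Discrete.Basic
import Mathlib.Combinatorics.Quiver.SingleObj
import HarnessLib

/-!
# [AbsTopIII] Def 3.5 (v): `SelfEquivalence.Isomorphic` (FACT-LIST F-0093) IS an equivalence
# relation ("isomorphism classes of self-equivalences"); its universal closure is REFUTED

S. Mochizuki, *Topics in absolute anabelian geometry III*, J. Math. Sci. Univ. Tokyo 22 (2015)
[MochizukiAbsTopIII2015], Definition 3.5 (v) pp. 76–77 (manuscript pages, lit key
`paper:url-5493eb38cbb7`): 2-morphisms of 1-morphisms of diagrams of categories, "[2-]isomorphic"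
1-morphisms, and `Aut(𝒟)` = "the group determined by the isomorphism classes of self-equivalences
of `𝒟`".

PROOF-ONLY companion of `DiagramMorphisms.lean` (abc-iut-L4-t2; no definition, no instance, nothing
restated), abc-iut cell seat abc-iut-f-095 (F fact-proving wave, tranche 95; FACT-LIST row **F-0093**
`DiagramOfCategories.SelfEquivalence.Isomorphic`, class `preparatory`, kernel_closedness
`parametrised`).  The row is a binary RELATION `Φ.Isomorphic Ψ` on self-equivalences of a diagram
`𝒟` (same morphism of graphs, 2-isomorphic 1-morphisms).  What print presupposes of it — and what
the tree's `Aut 𝒟 := Quot Isomorphic` needs in order to BE "the isomorphism classes" — is that it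
is an EQUIVALENCE RELATION; that is proved here from Mathlib's natural-isomorphism calculus:

* `OneMorphism.Isomorphic.refl/symm/trans` — identity, inverse (`inv_whiskerRight`,
  `inv_whiskerLeft`) and composite 2-isomorphisms; `OneMorphism.Isomorphic.equivalence`;
* `SelfEquivalence.Isomorphic.refl/symm/trans`, `SelfEquivalence.Isomorphic.equivalence`, and
  `Aut.mk_eq_mk_iff` — two self-equivalences have the same class in `Aut(𝒟)` iff they are
  isomorphic (so the `Quot` is an honest quotient by isomorphism);
* `OneMorphism.isomorphic_of_hom_nonempty_subsingleton` — over target categories all of whose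
  hom-sets are inhabited subsingletons, any two 1-morphisms over one graph morphism are isomorphic
  (used for the toy below).

As for every schema row (FACT-LIST rule R5) the fully quantified closure "`∀ 𝒟 Φ Ψ, Φ.Isomorphic Ψ`"
is NOT a theorem: `SelfEquivalence.not_forall_isomorphic` exhibits, on the one-vertex graph with two
loops `{0, 1}` carrying the terminal category and identity functors, the identity self-equivalence
and the loop-swapping self-equivalence, which are not isomorphic (different morphisms of graphs).
So the row is admissible only as the relation it is (FACT-LIST class «universal-closure REFUTED»),
never as a closed assumption.  Pure category theory; nothing here bears on the disputed [IUTchIII]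
Cor. 3.12 or takes a side; typed ≠ proved elsewhere.
-/

namespace Literature.AnabelianGeometry.AbsoluteAnabelian

open _root_.CategoryTheory _root_.Quiver

universe v u w

namespace DiagramOfCategories

variable {V : Type w} [Quiver.{v} V] {V' : Type w} [Quiver.{v} V']
  {F : V ⥤q V'} {D : DiagramOfCategories.{v, u, w} V} {D' : DiagramOfCategories.{v, u, w} V'}

/-! ### `OneMorphism.Isomorphic` is an equivalence relation (Def 3.5 (v), 2-morphisms) -/

/-- The identity 2-morphism: every 1-morphism is [2-]isomorphic to itself.
[cite: MochizukiAbsTopIII2015, Definition 3.5 (v) p.76] -/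
theorem OneMorphism.Isomorphic.refl (Φ : OneMorphism F D D') : Φ.Isomorphic Φ :=
  ⟨{ app := fun a => 𝟙 (Φ.app a)
     naturality := fun e => by
       rw [Functor.whiskerRight_id', Functor.whiskerLeft_id', Category.id_comp, Category.comp_id] },
    fun a => IsIso.id (Φ.app a)⟩

/-- The inverse 2-isomorphism: `Isomorphic` is symmetric.
[cite: MochizukiAbsTopIII2015, Definition 3.5 (v) p.76] -/
theorem OneMorphism.Isomorphic.symm {Φ Ψ : OneMorphism F D D'} (h : Φ.Isomorphic Ψ) :
    Ψ.Isomorphic Φ := by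
  obtain ⟨Θ, hΘ⟩ := h
  haveI : ∀ a, IsIso (Θ.app a) := hΘ
  refine ⟨{ app := fun a => inv (Θ.app a), naturality := fun {a b} e => ?_ }, fun a => ?_⟩
  · rw [← Functor.inv_whiskerRight, ← Functor.inv_whiskerLeft, IsIso.inv_comp_eq, ← Category.assoc,
      IsIso.eq_comp_inv]
    exact (Θ.naturality e).symm
  · change IsIso (inv (Θ.app a))
    infer_instance

/-- The composite 2-isomorphism: `Isomorphic` is transitive.
[cite: MochizukiAbsTopIII2015, Definition 3.5 (v) p.76] -/
theorem OneMorphism.Isomorphic.trans {Φ Ψ Ξ : OneMorphism F D D'} (h₁ : Φ.Isomorphic Ψ)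
    (h₂ : Ψ.Isomorphic Ξ) : Φ.Isomorphic Ξ := by
  obtain ⟨Θ₁, hΘ₁⟩ := h₁
  obtain ⟨Θ₂, hΘ₂⟩ := h₂
  refine ⟨{ app := fun a => Θ₁.app a ≫ Θ₂.app a, naturality := fun {a b} e => ?_ }, fun a => ?_⟩
  · rw [Functor.whiskerRight_comp, Functor.whiskerLeft_comp, Category.assoc, Θ₂.naturality e,
      reassoc_of% (Θ₁.naturality e)]
  · haveI := hΘ₁ a
    haveI := hΘ₂ a
    change IsIso (Θ₁.app a ≫ Θ₂.app a)
    infer_instance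

/-- **Def 3.5 (v): "[2-]isomorphic" is an equivalence relation on 1-morphisms `𝒟 → 𝒟'` over a
fixed morphism of graphs.** [cite: MochizukiAbsTopIII2015, Definition 3.5 (v) p.76] -/
theorem OneMorphism.Isomorphic.equivalence :
    Equivalence (OneMorphism.Isomorphic (F := F) (D := D) (D' := D')) :=
  ⟨OneMorphism.Isomorphic.refl, fun h => h.symm, fun h₁ h₂ => h₁.trans h₂⟩

/-- Over target categories whose hom-sets are all INHABITED SUBSINGLETONS (e.g. the terminal
category at every vertex), any two 1-morphisms over the same morphism of graphs are isomorphic: the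
unique candidate components are natural and invertible for want of competitors.
[cite: MochizukiAbsTopIII2015, Definition 3.5 (v) p.76] -/
theorem OneMorphism.isomorphic_of_hom_nonempty_subsingleton (Φ Ψ : OneMorphism F D D')
    (h₁ : ∀ (b : V') (x y : D'.obj b), Nonempty (x ⟶ y))
    (h₂ : ∀ (b : V') (x y : D'.obj b), Subsingleton (x ⟶ y)) : Φ.Isomorphic Ψ := by
  refine ⟨{ app := fun a =>
              { app := fun x => (h₁ _ _ _).some
                naturality := fun x y f => (h₂ _ _ _).elim _ _ }
            naturality := fun {a b} e => ?_ }, fun a => ?_⟩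
  · ext x
    exact (h₂ _ _ _).elim _ _
  · haveI : ∀ x : D.obj a, IsIso
        (({ app := fun x => (h₁ _ _ _).some
            naturality := fun x y f => (h₂ _ _ _).elim _ _ } : Φ.app a ⟶ Ψ.app a).app x) :=
      fun x => ⟨⟨(h₁ _ _ _).some, (h₂ _ _ _).elim _ _, (h₂ _ _ _).elim _ _⟩⟩
    exact NatIso.isIso_of_isIso_app _

/-! ### `SelfEquivalence.Isomorphic` is an equivalence relation; `Aut(𝒟)` is the set of classes -/

/-- Every self-equivalence is isomorphic to itself. [cite: MochizukiAbsTopIII2015, Definition 3.5 (v) p.77] -/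
theorem SelfEquivalence.Isomorphic.refl (Φ : D.SelfEquivalence) : Φ.Isomorphic Φ :=
  ⟨rfl, OneMorphism.Isomorphic.refl Φ.hom⟩

/-- `SelfEquivalence.Isomorphic` is symmetric. [cite: MochizukiAbsTopIII2015, Definition 3.5 (v) p.77] -/
theorem SelfEquivalence.Isomorphic.symm {Φ Ψ : D.SelfEquivalence} (h : Φ.Isomorphic Ψ) :
    Ψ.Isomorphic Φ := by
  obtain ⟨G₁, φ, hφ⟩ := Φ
  obtain ⟨G₂, ψ, hψ⟩ := Ψ
  obtain ⟨hG, hiso⟩ := h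
  dsimp only at hG
  subst hG
  exact ⟨rfl, hiso.symm⟩

/-- `SelfEquivalence.Isomorphic` is transitive. [cite: MochizukiAbsTopIII2015, Definition 3.5 (v) p.77] -/
theorem SelfEquivalence.Isomorphic.trans {Φ Ψ Ξ : D.SelfEquivalence} (h₁ : Φ.Isomorphic Ψ)
    (h₂ : Ψ.Isomorphic Ξ) : Φ.Isomorphic Ξ := by
  obtain ⟨G₁, φ, hφ⟩ := Φ
  obtain ⟨G₂, ψ, hψ⟩ := Ψ
  obtain ⟨G₃, ξ, hξ⟩ := Ξ
  obtain ⟨hG, hiso⟩ := h₁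
  obtain ⟨hG', hiso'⟩ := h₂
  dsimp only at hG hG'
  subst hG
  subst hG'
  exact ⟨rfl, hiso.trans hiso'⟩

/-- **F-0093, structural content: Def 3.5 (v)'s "isomorphism classes of self-equivalences" are the
classes of an EQUIVALENCE RELATION.** [cite: MochizukiAbsTopIII2015, Definition 3.5 (v) p.77] -/
theorem SelfEquivalence.Isomorphic.equivalence :
    Equivalence
      (Literature.AnabelianGeometry.AbsoluteAnabelian.DiagramOfCategories.SelfEquivalence.Isomorphic
        (D := D)) :=
  ⟨SelfEquivalence.Isomorphic.refl, fun h => h.symm, fun h₁ h₂ => h₁.trans h₂⟩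

/-- Consequently two self-equivalences have the same class in `Aut(𝒟)` (typed as
`Quot Isomorphic`) if and only if they are isomorphic — `Aut(𝒟)` IS the set of isomorphism classes.
[cite: MochizukiAbsTopIII2015, Definition 3.5 (v) p.77] -/
theorem Aut.mk_eq_mk_iff (Φ Ψ : D.SelfEquivalence) :
    (Quot.mk SelfEquivalence.Isomorphic Φ : D.Aut) = Quot.mk SelfEquivalence.Isomorphic Ψ ↔
      Φ.Isomorphic Ψ :=
  ⟨fun h => (SelfEquivalence.Isomorphic.equivalence.eqvGen_iff).mp (Quot.eqvGen_exact h),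
    fun h => Quot.sound h⟩

/-! ### F-0093: the universal closure of the relation is false -/

/-- **F-0093, universal closure REFUTED.**  On the one-vertex oriented graph with two loops
(`Quiver.SingleObj Bool`) let `𝒟` carry the terminal category at the vertex and the identity
functor on both loops.  The identity self-equivalence and the self-equivalence swapping the two
loops (identity functor, identity 2-cells; it is its own quasi-inverse) are NOT isomorphic — their
morphisms of graphs differ — so "`∀ 𝒟 Φ Ψ, Φ.Isomorphic Ψ`" is not a theorem: the row is a
relation, to be asserted only of specific pairs. [cite: MochizukiAbsTopIII2015, Definition 3.5 (v) p.77] -/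
theorem SelfEquivalence.not_forall_isomorphic :
    ¬ ∀ (W : Type) [Quiver.{0} W] (𝒟 : DiagramOfCategories.{0, 0, 0} W) (Φ Ψ : 𝒟.SelfEquivalence),
        Literature.AnabelianGeometry.AbsoluteAnabelian.DiagramOfCategories.SelfEquivalence.Isomorphic
          Φ Ψ := by
  intro h
  -- the toy diagram: one vertex, loops indexed by `Bool`, terminal category, identity functors
  let C : Type := Discrete PUnit.{1}
  let 𝒟 : DiagramOfCategories.{0, 0, 0} (Quiver.SingleObj Bool) := { obj := fun _ => C, map := fun _ => 𝟭 C }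
  have hC₁ : ∀ (b : Quiver.SingleObj Bool) (x y : 𝒟.obj b), Nonempty (x ⟶ y) :=
    fun _ x y => ⟨Discrete.eqToHom (Subsingleton.elim _ _)⟩
  have hC₂ : ∀ (b : Quiver.SingleObj Bool) (x y : 𝒟.obj b), Subsingleton (x ⟶ y) :=
    fun _ x y => inferInstanceAs (Subsingleton ((x : Discrete PUnit.{1}) ⟶ y))
  -- the loop swap `σ`, an involution of the graph
  let σ : Quiver.SingleObj Bool ⥤q Quiver.SingleObj Bool := Quiver.SingleObj.toPrefunctor (fun b : Bool => !b)
  have hσ : σ ⋙q σ = 𝟭q (Quiver.SingleObj Bool) :=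
    Prefunctor.ext (fun _ => rfl) fun _ _ b => by
      change (!!b) = b
      exact Bool.not_not b
  -- the 1-morphism over `σ`: identity functor, identity 2-cells
  let S : OneMorphism σ 𝒟 𝒟 := { app := fun _ => 𝟭 C, iso := fun _ => Iso.refl _ }
  let Ψ : 𝒟.SelfEquivalence :=
    { graphMap := σ, hom := S,
      isEquivalence := ⟨σ, S, hσ, hσ,
        OneMorphism.isomorphic_of_hom_nonempty_subsingleton _ _ hC₁ hC₂,
        OneMorphism.isomorphic_of_hom_nonempty_subsingleton _ _ hC₁ hC₂⟩ }
  let Φ : 𝒟.SelfEquivalence :=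
    { graphMap := 𝟭q (Quiver.SingleObj Bool), hom := OneMorphism.id 𝒟,
      isEquivalence := ⟨𝟭q (Quiver.SingleObj Bool), OneMorphism.id 𝒟, rfl, rfl,
        OneMorphism.isomorphic_of_hom_nonempty_subsingleton _ _ hC₁ hC₂,
        OneMorphism.isomorphic_of_hom_nonempty_subsingleton _ _ hC₁ hC₂⟩ }
  obtain ⟨hgraph, -⟩ := h (Quiver.SingleObj Bool) 𝒟 Φ Ψ
  have hg : 𝟭q (Quiver.SingleObj Bool) = σ := hgraph
  have hmap : (𝟭q (Quiver.SingleObj Bool)).map (Quiver.SingleObj.toHom true) =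
      σ.map (Quiver.SingleObj.toHom true) := by
    rw [hg]
  exact Bool.noConfusion hmap

/-! ### F-0092: the universal closure of `OneMorphism.Isomorphic` is false -/

/-- **F-0092, universal closure REFUTED.**  On the one-vertex graph WITHOUT edges
(`Quiver.SingleObj PEmpty`) let `𝒟` carry the discrete category on `Bool`.  The identity 1-morphism
and the 1-morphism over the identity graph morphism whose functor is constant at `true` are NOT
[2-]isomorphic — a 2-morphism between them would have a component `false ⟶ true` in `Discrete Bool`.
So "`∀ 𝒟 𝒟' Φ Ψ, Φ.Isomorphic Ψ`" is not a theorem: the row (FACT-LIST F-0092) is a RELATION, to be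
asserted of specific pairs only (as in `LogFrobeniusData.ShiftStmt`, [AbsTopIII] Cor. 3.6 (v)).
[cite: MochizukiAbsTopIII2015, Definition 3.5 (v) p.76] -/
theorem OneMorphism.not_forall_isomorphic :
    ¬ ∀ (W W' : Type) [Quiver.{0} W] [Quiver.{0} W'] (F : W ⥤q W')
        (𝒟 : DiagramOfCategories.{0, 0, 0} W) (𝒟' : DiagramOfCategories.{0, 0, 0} W')
        (Φ Ψ : OneMorphism F 𝒟 𝒟'),
        Literature.AnabelianGeometry.AbsoluteAnabelian.DiagramOfCategories.OneMorphism.Isomorphic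
          Φ Ψ := by
  intro h
  let C : Type := Discrete Bool
  let 𝒟 : DiagramOfCategories.{0, 0, 0} (Quiver.SingleObj PEmpty.{1}) :=
    { obj := fun _ => C, map := fun e => PEmpty.elim e }
  let Ψ : OneMorphism (𝟭q (Quiver.SingleObj PEmpty.{1})) 𝒟 𝒟 :=
    { app := fun _ => (Functor.const C).obj (⟨true⟩ : Discrete Bool), iso := fun e => PEmpty.elim e }
  obtain ⟨Θ, -⟩ := h _ _ (𝟭q (Quiver.SingleObj PEmpty.{1})) 𝒟 𝒟 (OneMorphism.id 𝒟) Ψ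
  have f : (⟨false⟩ : Discrete Bool) ⟶ (⟨true⟩ : Discrete Bool) :=
    (Θ.app (Quiver.SingleObj.star PEmpty.{1})).app (⟨false⟩ : Discrete Bool)
  exact Bool.noConfusion (Discrete.eq_of_hom f)

end DiagramOfCategories

end Literature.AnabelianGeometry.AbsoluteAnabelian
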